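import Mathlib.Algebra.Order.Round
import Mathlib.Data.Fintype.BigOperators
import Mathlib.Data.Fintype.Pigeonhole
import Mathlib.Tactic.FieldSimp
import Mathlib.Tactic.Linarith
import Mathlib.Tactic.Positivity
import Mathlib.Tactic.Ring
import Mathlib.Tactic.WLOG
import HarnessLib

/-!
# Distance to the nearest integer and Dirichlet's theorem on simultaneous approximation

Topic `NumberTheory/DiophantineApproximation`. This file supplies the number-theoretic half of
the definition request `SimultaneousApproxInstance` (route `PneNP/DirichletPigeons`): the
function `‖x‖ = min_{p ∈ ℤ} |x - p|` in which the GOOD SIMULTANEOUS APPROXIMATION problem of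
Lagarias (1985) and the total search problem DIRICHLET are phrased, and Dirichlet's theorem on
simultaneous approximation in the pigeonhole form those problems use, PROVED.

## Main definitions and results

* `distNearestInt x = |x - round x|`: the distance from `x` to the nearest integer, for any
  linearly ordered ring with a floor function (so for `ℚ`, the case the computational problems
  need, and for `ℝ`). On `ℝ` it is *the same term* as the sieve-theory helper
  `Literature.NumberTheory.Sieve.Vinogradov.distInt` (`|x - round x|`, file
  `Literature/NumberTheory/Sieve/VinogradovExpSumTools.lean`); it is re-introduced here only at
  the generality (`ℚ`) that file does not provide, and without importing analysis.
* `distNearestInt_le_abs_sub_intCast`, `distNearestInt_le_iff_exists_int`,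
  `distNearestInt_lt_iff_exists_int`: `‖x‖` is the minimum of `|x - p|` over `p ∈ ℤ`, so that
  "`∃ p, |q α - p| ≤ ε`" (Lagarias' formulation) and "`‖q α‖ ≤ ε`" agree.
* `exists_nat_distNearestInt_intCast_div_natCast`: for `x = k/b` the distance is a multiple
  of `1/b` (used by the search-to-decision glue of the route: `‖q a/b‖ < 1/Q ↔ ‖q a/b‖ ≤ (⌈b/Q⌉-1)/b`).
* `exists_forall_distNearestInt_natCast_mul_lt` — **Dirichlet's theorem on simultaneous
  approximation** (Dirichlet 1842), pigeonhole form: for `α₁, …, α_d` and an integer `Q ≥ 1`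
  there is a natural number `q` with `1 ≤ q ≤ Q^d` and `‖q αᵢ‖ < 1/Q` for every `i`.
  Hardy–Wright prove exactly this on the way to their Theorem 200 (§11.12: the `Q^k + 1` points
  `({l ξ₁}, …, {l ξ_k})`, `0 ≤ l ≤ Q^k`, in `Q^k` boxes of side `1/Q`; two in one box, `q = l₂ - l₁`);
  Schmidt (1980), Ch. II, Theorem 1A states the neighbouring normalisation `1 ≤ q < Q^n`,
  `|αᵢ q - pᵢ| ≤ 1/Q` (for `Q > 1`). We prove the Hardy–Wright form, which is the one the
  route's problem DIRICHLET asks to solve, over any linearly ordered field with a floor function.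

## References

* G. H. Hardy, E. M. Wright, *An Introduction to the Theory of Numbers*, 6th ed. (2008), §11.12,
  Theorem 200 and its proof [HardyWright2008].
* W. M. Schmidt, *Diophantine Approximation*, LNM 785 (1980), Ch. II, §1, Theorem 1A [Schmidt1980].
* J. C. Lagarias, *The computational complexity of simultaneous Diophantine approximation
  problems*, SIAM J. Comput. 14 (1985) 196–209 (the notation `‖·‖` / `{{·}}`) [Lagarias1985].

What is NOT here: the asymptotic corollaries (HW Thm 200 itself: infinitely many solutions of
`|ξᵢ - pᵢ/q| < q^{-1-1/k}` for an irrational `ξᵢ`; Schmidt's Cor. 1B–1F, linear forms Thm 1C/1E),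
Kronecker's theorem (see `KroneckerTheorem.lean` in this directory), and everything computational
(`SimultaneousApproxComplexity.lean`).
-/

namespace Literature.NumberTheory.DiophantineApproximation

section Ring

variable {K : Type*} [Ring K] [LinearOrder K] [FloorRing K]

/-- The distance from `x` to the nearest integer, `‖x‖ = |x - round x| = min_{p ∈ ℤ} |x - p|`
(the `‖x‖`, or `{{x}}`, of Diophantine approximation; Lagarias 1985 writes the GOOD SIMULTANEOUS
APPROXIMATION problem with it). Defined for every linearly ordered ring with a floor function; on
`ℝ` it is the same term as `Literature.NumberTheory.Sieve.Vinogradov.distInt`. [folklore] -/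
def distNearestInt (x : K) : K := |x - round x|

/-- Unfolding lemma: `‖x‖ = |x - round x|`. [folklore] -/
theorem distNearestInt_def (x : K) : distNearestInt x = |x - round x| := rfl

variable [IsStrictOrderedRing K]

/-- `0 ≤ ‖x‖`. [folklore] -/
theorem distNearestInt_nonneg (x : K) : 0 ≤ distNearestInt x := abs_nonneg _

/-- `‖x‖ ≤ |x - p|` for every integer `p`: `round x` is a nearest integer
(Mathlib `round_le`). [folklore] -/
theorem distNearestInt_le_abs_sub_intCast (x : K) (p : ℤ) : distNearestInt x ≤ |x - p| :=
  round_le x p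

/-- `‖x‖ ≤ ε ↔ ∃ p ∈ ℤ, |x - p| ≤ ε`: the two formulations of "`x` is within `ε` of an integer"
(Lagarias 1985 states GSA with `∃ p`, the route with `‖·‖`). [folklore] -/
theorem distNearestInt_le_iff_exists_int (x ε : K) :
    distNearestInt x ≤ ε ↔ ∃ p : ℤ, |x - p| ≤ ε :=
  ⟨fun h => ⟨round x, h⟩, fun ⟨p, hp⟩ => (distNearestInt_le_abs_sub_intCast x p).trans hp⟩

/-- `‖x‖ < ε ↔ ∃ p ∈ ℤ, |x - p| < ε`. [folklore] -/
theorem distNearestInt_lt_iff_exists_int (x ε : K) :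
    distNearestInt x < ε ↔ ∃ p : ℤ, |x - p| < ε :=
  ⟨fun h => ⟨round x, h⟩, fun ⟨p, hp⟩ => (distNearestInt_le_abs_sub_intCast x p).trans_lt hp⟩

/-- `‖p‖ = 0` for an integer `p`. [folklore] -/
@[simp] theorem distNearestInt_intCast (p : ℤ) : distNearestInt (p : K) = 0 := by
  simp [distNearestInt]

/-- `‖0‖ = 0`. [folklore] -/
@[simp] theorem distNearestInt_zero : distNearestInt (0 : K) = 0 := by
  simp [distNearestInt]

/-- `‖n‖ = 0` for a natural number `n`. [folklore] -/
@[simp] theorem distNearestInt_natCast (n : ℕ) : distNearestInt (n : K) = 0 := by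
  simpa using distNearestInt_intCast (K := K) n

/-- `‖1‖ = 0`. [folklore] -/
@[simp] theorem distNearestInt_one : distNearestInt (1 : K) = 0 := by
  simpa using distNearestInt_intCast (K := K) 1

/-- `‖x + p‖ = ‖x‖` for an integer `p` (periodicity). [folklore] -/
@[simp] theorem distNearestInt_add_intCast (x : K) (p : ℤ) :
    distNearestInt (x + p) = distNearestInt x := by
  simp [distNearestInt, round_add_intCast]

/-- `‖p + x‖ = ‖x‖` for an integer `p` (periodicity). [folklore] -/
@[simp] theorem distNearestInt_intCast_add (p : ℤ) (x : K) :
    distNearestInt (p + x) = distNearestInt x := by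
  rw [add_comm, distNearestInt_add_intCast]

/-- `‖x - p‖ = ‖x‖` for an integer `p` (periodicity). [folklore] -/
@[simp] theorem distNearestInt_sub_intCast (x : K) (p : ℤ) :
    distNearestInt (x - p) = distNearestInt x := by
  rw [sub_eq_add_neg, ← Int.cast_neg, distNearestInt_add_intCast]

end Ring

section Field

variable {K : Type*} [Field K] [LinearOrder K] [IsStrictOrderedRing K] [FloorRing K]

/-- `‖x‖ ≤ 1/2` (Mathlib `abs_sub_round`). [folklore] -/
theorem distNearestInt_le_half (x : K) : distNearestInt x ≤ 1 / 2 := abs_sub_round x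

/-- For a rational point `k/b` (`k ∈ ℤ`, `b ≥ 1`) the distance to the nearest integer is a
multiple of `1/b`: `‖k/b‖ = m/b` for some natural number `m` (indeed `m = min (k mod b, b - k mod b)`,
Mathlib `abs_sub_round_div_natCast_eq`). This is why, for `α = a/b`, the strict condition
`‖q αᵢ‖ < 1/Q` of DIRICHLET is a non-strict GSA condition `‖q αᵢ‖ ≤ (⌈b/Q⌉ - 1)/b`. [folklore] -/
theorem exists_nat_distNearestInt_intCast_div_natCast (k : ℤ) {b : ℕ} (hb : 0 < b) :
    ∃ m : ℕ, distNearestInt ((k : K) / b) = (m : K) / b := by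
  -- reduce `k` modulo `b`: `k / b = (k / b : ℤ) + (k % b : ℕ) / b` in `K`
  have hbK : (b : K) ≠ 0 := by exact_mod_cast hb.ne'
  obtain ⟨r, hr⟩ : ∃ r : ℕ, (r : ℤ) = k % b := ⟨(k % b).toNat, Int.toNat_of_nonneg
    (Int.emod_nonneg _ (by exact_mod_cast hb.ne'))⟩
  have h : (r : ℤ) + b * (k / b) = k := by rw [hr]; exact Int.emod_add_mul_ediv k b
  have hcast : (k : K) = (r : K) + (b : K) * ((k / b : ℤ) : K) := by exact_mod_cast h.symm
  have hk : (k : K) / b = ((k / b : ℤ) : K) + (r : K) / b := by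
    rw [hcast]; field_simp; ring
  refine ⟨min (r % b) (b - r % b), ?_⟩
  rw [hk, distNearestInt_intCast_add, distNearestInt_def, abs_sub_round_div_natCast_eq]

/-- **Dirichlet's theorem on simultaneous approximation** (Dirichlet 1842), pigeonhole form: for
`α₁, …, α_d` in a linearly ordered field with floor (e.g. `ℚ`, `ℝ`) and an integer `Q ≥ 1` there
is a natural number `q` with `1 ≤ q ≤ Q^d` and `‖q αᵢ‖ < 1/Q` for every `i`. Proof as in
Hardy–Wright §11.12 (proof of Thm 200): the `Q^d + 1` points `({l α₁}, …, {l α_d})`, `0 ≤ l ≤ Q^d`,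
fall into `Q^d` boxes `∏ [mᵢ/Q, (mᵢ+1)/Q)`; two of them, `l₁ < l₂`, share a box, and `q = l₂ - l₁`
works since `q αᵢ - (⌊l₂ αᵢ⌋ - ⌊l₁ αᵢ⌋) = {l₂ αᵢ} - {l₁ αᵢ} ∈ (-1/Q, 1/Q)`. Schmidt 1980, Ch. II,
Thm 1A is the normalisation `1 ≤ q < Q^d`, `|αᵢ q - pᵢ| ≤ 1/Q`; `d = 0` gives `q = 1`.
[cite: HardyWright2008, §11.12 (proof of Theorem 200)] [cite: Schmidt1980, Ch. II §1 Theorem 1A] -/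
theorem exists_forall_distNearestInt_natCast_mul_lt {d : ℕ} (α : Fin d → K) {Q : ℕ} (hQ : 1 ≤ Q) :
    ∃ q : ℕ, 1 ≤ q ∧ q ≤ Q ^ d ∧ ∀ i, distNearestInt ((q : K) * α i) < 1 / (Q : K) := by
  have hQK : (0 : K) < Q := by exact_mod_cast hQ
  -- the box of the point `({l α₁}, …, {l α_d})`: `i ↦ ⌊{l αᵢ} Q⌋₊ < Q`
  let box : Fin (Q ^ d + 1) → Fin d → Fin Q := fun l i =>
    ⟨⌊Int.fract ((l : K) * α i) * Q⌋₊,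
      (Nat.floor_lt (mul_nonneg (Int.fract_nonneg _) (Nat.cast_nonneg _))).2
      (by simpa using mul_lt_mul_of_pos_right (Int.fract_lt_one ((l : K) * α i)) hQK)⟩
  have hcard : Fintype.card (Fin d → Fin Q) < Fintype.card (Fin (Q ^ d + 1)) := by
    rw [Fintype.card_fun, Fintype.card_fin, Fintype.card_fin, Fintype.card_fin]
    exact Nat.lt_succ_self _
  obtain ⟨x, y, hxy, hbox⟩ := Fintype.exists_ne_map_eq_of_card_lt box hcard
  -- without loss of generality `x < y`
  wlog hlt : (x : ℕ) < y generalizing x y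
  · exact this y x hxy.symm hbox.symm
      (lt_of_le_of_ne (not_lt.mp hlt) fun h => hxy (Fin.ext h).symm)
  refine ⟨y - x, Nat.sub_pos_of_lt hlt, (Nat.sub_le _ _).trans (Nat.lt_succ_iff.mp y.isLt),
    fun i => ?_⟩
  -- two points of one box are `< 1/Q` apart in each coordinate
  have hi : (box x i : ℕ) = box y i := by rw [hbox]
  simp only [box] at hi
  set u := Int.fract ((x : K) * α i) with hu
  set v := Int.fract ((y : K) * α i) with hv
  have hu0 : 0 ≤ u * Q := mul_nonneg (Int.fract_nonneg _) hQK.le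
  have hv0 : 0 ≤ v * Q := mul_nonneg (Int.fract_nonneg _) hQK.le
  have h1 := Nat.floor_le hu0
  have h2 := Nat.lt_floor_add_one (u * Q)
  have h3 := Nat.floor_le hv0
  have h4 := Nat.lt_floor_add_one (v * Q)
  rw [hi] at h1 h2
  have hvu : |v - u| * Q < 1 := by
    rw [← abs_of_pos hQK, ← abs_mul, sub_mul]
    exact abs_sub_lt_iff.2 ⟨by linarith, by linarith⟩
  have hvu' : |v - u| < 1 / (Q : K) := by
    rw [lt_div_iff₀ hQK]; simpa using hvu
  -- `q αᵢ` differs from the integer `⌊y αᵢ⌋ - ⌊x αᵢ⌋` by `v - u`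
  calc distNearestInt (((y - x : ℕ) : K) * α i)
      ≤ |((y - x : ℕ) : K) * α i - ((⌊(y : K) * α i⌋ - ⌊(x : K) * α i⌋ : ℤ) : K)| :=
        distNearestInt_le_abs_sub_intCast _ _
    _ = |v - u| := by
        congr 1
        rw [hu, hv, Int.fract, Int.fract, Nat.cast_sub hlt.le]
        push_cast
        ring
    _ < 1 / (Q : K) := hvu'

/-- Dirichlet's theorem in the `∃ p` form of Schmidt 1980, Ch. II, Thm 1A / Hardy–Wright Thm 200
(proof): integers `q, p₁, …, p_d` with `1 ≤ q ≤ Q^d` and `|q αᵢ - pᵢ| < 1/Q`.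
[cite: HardyWright2008, §11.12 (proof of Theorem 200)] -/
theorem exists_forall_abs_natCast_mul_sub_intCast_lt {d : ℕ} (α : Fin d → K) {Q : ℕ}
    (hQ : 1 ≤ Q) :
    ∃ (q : ℕ) (p : Fin d → ℤ), 1 ≤ q ∧ q ≤ Q ^ d ∧ ∀ i, |(q : K) * α i - p i| < 1 / (Q : K) := by
  obtain ⟨q, hq1, hqQ, h⟩ := exists_forall_distNearestInt_natCast_mul_lt α hQ
  exact ⟨q, fun i => round ((q : K) * α i), hq1, hqQ, h⟩

end Field

end Literature.NumberTheory.DiophantineApproximation
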